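import Literature.Analysis.FluidPDE.SelfSimilarLiouville
import HarnessLib

/-!
# Removing discretely self-similar singularities for `λ` close to `1` (Chae–Wolf 2017, Thms. 1.1, 1.3, 1.5)

Analysis/FluidPDE named-fact file. D. Chae, J. Wolf, *Removing discretely self-similar singularities
for the 3D Navier–Stokes equations*, Comm. PDE 42 (2017) 1359–1374 = arXiv:1610.09464 (held:
paper:arxiv-1610.09464, p. 3 of the text). Setting (§1): the Navier–Stokes equations (1.1)
`∂ₜu + (u·∇)u − Δu = −∇π`, `∇·u = 0` in `ℝ³` (viscosity `1`); `Q = ℝ³ × (−∞, 0)`; `u : Q → ℝ³` is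
backward `λ`-discretely self-similar (`λ`-DSS), `λ > 1`, if `u(x,t) = λu(λx, λ²t)` on `Q` (1.2).

**Theorem 1.3** (verbatim): "For every `C_* > 0` there exists `λ_* > 1` depending on `C_*` such that
if `u ∈ C^∞(Q)` is a `λ`-DSS solution [to] the Navier–Stokes equations for `λ ∈ (1, λ_*)`, which
satisfies `|u(x,t)| ≤ C_*/(√(−t) + |x|)` for all `(x,t) ∈ Q` (1.7), then `u ≡ 0`."
(Remark 1.4: for `C_*` small every such solution is trivial by the Gustafson–Kang–Tsai criterion.
Thm. 1.1: `λ`-DSS solutions in `C((−∞,0); Lᵖ) ∩ C^∞(Q)`, `3 ≤ p < ∞`, are regular off the origin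
and obey (1.7) for some `C`.)

**Vendored** as `chaeWolf2017_removing_dss`, in the vocabulary of `SelfSimilar.lean` /
`SelfSimilarLiouville.lean` (the wall `TypeIDSSLiouville λ` is the same statement for ALL `λ > 1` in
the ancient mild class): for every `C₀ > 0` there is `c₁ > 1` such that for `1 < c < c₁`, every
classical solution `(u, p)` of Navier–Stokes with `ν = 1`, `f = 0` on the time set `(−∞, 0)`
(`IsClassicalNSSolutionOn (Iio 0) 1 0 u p`: `u`, `p` jointly `C^∞` on `(−∞,0) × ℝ³`, the
equations pointwise — the printed "`u ∈ C^∞(Q)` is a solution", with the pressure made explicit)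
which is `c`-DSS (`IsDiscretelySelfSimilar c u`, the relation `λu(λ²t, λx) = u(t,x)` imposed at all
times, which for fields on `Q` extended arbitrarily to `t ≥ 0` only adds a vacuous constraint — the
convention of the wall, see the module docstring of `SelfSimilarLiouville.lean`) and satisfies the
Type I bound `‖u(t,x)‖ ≤ C₀/(‖x‖ + √(−t))` for `t < 0` (`HasTypeIDecay C₀ u`, (1.7)) vanishes
identically on `Q`. The quantitative re-proof of Pineau–Vicol 2026 (arXiv:2607.09619, Thm. 1.6) is
not vendored here (see `PineauVicolRSS.lean`).

**Theorem 1.1** (verbatim): "For `3 ≤ p < +∞` let `u ∈ C((−∞, 0); Lᵖ(ℝ³)) ∩ C^∞(Q)` be a solution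
to the Navier–Stokes equations, and `λ`-DSS for some `λ ∈ (1, +∞)`. Then the solution `u` is regular
on `Q̄ ∖ {(0,0)}`, and satisfies the estimate `|u(x,t)| ≤ C/(√(−t) + |x|)` `∀ (x,t) ∈ Q` (1.5)."
**Vendored** as `chaeWolf2017_dss_typeI_decay`: for `3 ≤ q < ∞`, `c > 1`, every classical solution
`(u, p)` (`ν = 1`, `f = 0`) on the time set `(−∞,0)` whose slices `u(t)`, `t < 0`, lie in `L^q(ℝ³)`
and depend continuously on `t` in `L^q` (the printed `u ∈ C((−∞,0); Lᵖ)`), and which is `c`-DSS,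
obeys a Type I bound `HasTypeIDecay C u` for some `C` (1.5). The printed "regular on
`Q̄ ∖ {(0,0)}`" (boundedness, indeed smoothness, near every `(x₀, 0)`, `x₀ ≠ 0`) is implied near
`t = 0` by (1.5) (`|u| ≤ C/|x| ≤ 2C/|x₀|` on `|x − x₀| < |x₀|/2`) and is not restated. Grounds
`Summit.NavierStokesRegularity.NavierStokesRegularity.Theses.DulacContraction.WallImpliesRDSSLiouville`
(stmt-NavierStokesRegularity-8563 wants a "Thm 1.1-type lemma" deriving the SPACE decay of a
Type-I-rate (R)DSS profile; NOTE the item's class is the local-energy class with `typeIBound < ∞`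
and only the time rate `|u| ≤ C/√(−t)`, NOT `C((−∞,0); Lᵖ)` — the printed theorem is the model,
not a drop-in) and `…RDSSLiouvilleInClass` (stmt-8561, case `t* = 0, x* ≠ 0`).

**Theorem 1.5** (verbatim, pp. 3–4): "Let `3 ≤ p < +∞` and `u ∈ C([0, t_*); Lᵖ(ℝ³))` be a local in
time smooth solution to (NS). Suppose there exists `v(x,t) ∈ C((−∞, 0); Lᵖ(ℝ³))`, fulfilling the
inequality (1.7), which is a `λ`-DSS function with respect to `(x_*, t_*)` with `λ ∈ (1, λ_*)` for
`λ_*` according to Theorem 1.3 such that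
`lim_{t→t_*} (t_*−t)^{(p−3)/(2p)} sup_{t<τ<t_*} ‖u(·,τ) − v(·,τ)‖_{Lᵖ(B_{R√(t_*−t)}(x_*))} = 0` for all
`R > 0` (1.8). Then, `v = 0`, and `(x_*, t_*)` is a regular point." Remark 1.6: "`v` in (1.8) is a DSS
function (not DSS solution of NS)". **Vendored** as `chaeWolf2017_asymptoticallyDSS_regular` (the
"asymptotically discretely self-similar singularity" exclusion, after Giga–Kohn): the model `v` is
written in the variables centred at `(t_*, x_*)`, i.e. as a field `w` on `(−∞,0) × ℝ³` with
`v(τ, x) = w(τ − t_*, x − x_*)`, so that "`λ`-DSS with respect to `(x_*, t_*)`" reads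
`IsDiscretelySelfSimilar c w` and (1.7) reads `HasTypeIDecay C₀ w`; `u` is a classical solution on the
time set `[0, t_*)` with slices continuous in `L^q`; the conclusion is `w(s) = 0` a.e. for every
`s < 0` (the printed `v = 0` in `C((−∞,0); Lᵖ)`) together with boundedness of `u` on a backward
parabolic cylinder `(t_* − r², t_*) × B(x_*, r)` (the printed "regular point", Caffarelli–Kohn–
Nirenberg; this is `IsBackwardBoundedAt u t_* x_*` of `SereginSverak2002PressureLowerBound.lean`,
unfolded here to keep the imports unchanged). Not discharged here (printed proof: §4, "similar to
the proof of Theorem 1.2 in [Chae, Nonlinear Anal. 125 (2015)]", over Theorem 1.3).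

Consumers: route NavierStokesRegularity/QuarterTurnRdss (support item NearIdentityRemoval,
stmt-NavierStokesRegularity-1102), routes Blowup (#5) and DssFarFieldSlaving, barrier entry
`LeraySelfSimilarBlowupExclusion` (evasions_known).

## References

* D. Chae, J. Wolf, Comm. PDE 42 (2017) 1359–1374, doi:10.1080/03605302.2017.1358275 =
  arXiv:1610.09464: §1, (1.1), (1.2), **Thm. 1.1** with (1.5), Remark 1.2, **Thm. 1.3**, Remark 1.4 (p. 3), **Thm. 1.5**, Remark 1.6 (pp. 3–4), §4 (p. 10).
  [ChaeWolf2017RemovingDSS]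
* Z. Bradshaw, T.-P. Tsai, Comm. PDE 42 (2017), §5 Open Problem 5.1 (the wall). [BradshawTsai2017CPDE]
-/

noncomputable section

open MeasureTheory Set

namespace Literature.Analysis.FluidPDE

/-- Local notation for physical space `ℝ³ = EuclideanSpace ℝ (Fin 3)`. -/
local notation "ℝ³" => EuclideanSpace ℝ (Fin 3)

/-- **Chae–Wolf 2017, Theorem 1.3 (removing `λ`-DSS singularities for `λ` close to `1`).**
"For every `C_* > 0` there exists `λ_* > 1` depending on `C_*` such that if `u ∈ C^∞(Q)` is a
`λ`-DSS solution to the Navier–Stokes equations for `λ ∈ (1, λ_*)`, which satisfies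
`|u(x,t)| ≤ C_*/(√(−t) + |x|)` for all `(x,t) ∈ Q = ℝ³ × (−∞,0)`, then `u ≡ 0`." Statement: for
every `C₀ > 0` there is `c₁ > 1` such that for every `c ∈ (1, c₁)`, every classical solution
`(u, p)` of the unforced Navier–Stokes equations with viscosity `1` on the time set `(−∞, 0)`
(`IsClassicalNSSolutionOn (Iio 0) 1 0 u p`) which is `c`-discretely self-similar
(`IsDiscretelySelfSimilar c u`: `c u(c²t, cx) = u(t, x)`) and obeys the Type I bound
`HasTypeIDecay C₀ u` (`‖u(t,x)‖ ≤ C₀/(‖x‖ + √(−t))`, `t < 0`) vanishes: `u(t, x) = 0` for all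
`t < 0` and all `x`. [cite: ChaeWolf2017RemovingDSS, Theorem 1.3 (arXiv:1610.09464 p. 3)] -/
def chaeWolf2017_removing_dss : Prop :=
  ∀ C₀ : ℝ, 0 < C₀ → ∃ c₁ : ℝ, 1 < c₁ ∧ ∀ c : ℝ, 1 < c → c < c₁ →
    ∀ (u : ℝ → ℝ³ → ℝ³) (p : ℝ → ℝ³ → ℝ), IsClassicalNSSolutionOn (Iio 0) 1 0 u p →
      IsDiscretelySelfSimilar c u → HasTypeIDecay C₀ u → ∀ t < 0, ∀ x, u t x = 0

/-! ### Consequences -/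

/-- Under the fact, the conclusion in the a.e. form of the wall `TypeIDSSLiouville`: the slices
`u t`, `t < 0`, vanish almost everywhere. [cite: ChaeWolf2017RemovingDSS, Theorem 1.3] -/
theorem chaeWolf2017_removing_dss.ae_eq_zero (h : chaeWolf2017_removing_dss) {C₀ : ℝ}
    (hC₀ : 0 < C₀) : ∃ c₁ : ℝ, 1 < c₁ ∧ ∀ c : ℝ, 1 < c → c < c₁ →
      ∀ (u : ℝ → ℝ³ → ℝ³) (p : ℝ → ℝ³ → ℝ), IsClassicalNSSolutionOn (Iio 0) 1 0 u p →
        IsDiscretelySelfSimilar c u → HasTypeIDecay C₀ u → ∀ t < 0, u t =ᵐ[volume] 0 := by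
  obtain ⟨c₁, hc₁, hc⟩ := h C₀ hC₀
  refine ⟨c₁, hc₁, fun c h1 h2 u p hsol hdss hI t ht => Filter.Eventually.of_forall fun x => ?_⟩
  exact hc c h1 h2 u p hsol hdss hI t ht x

/-- Monotonicity in the constant: a removal threshold for `C₀` serves every smaller Type I constant
`0 < C₀' ≤ C₀` (a bound with `C₀'` is a bound with `C₀`). [folklore] -/
theorem chaeWolf2017_removing_dss.of_le (h : chaeWolf2017_removing_dss) {C₀ C₀' : ℝ}
    (hC₀' : 0 < C₀') (hle : C₀' ≤ C₀) : ∃ c₁ : ℝ, 1 < c₁ ∧ ∀ c : ℝ, 1 < c → c < c₁ →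
      ∀ (u : ℝ → ℝ³ → ℝ³) (p : ℝ → ℝ³ → ℝ), IsClassicalNSSolutionOn (Iio 0) 1 0 u p →
        IsDiscretelySelfSimilar c u → HasTypeIDecay C₀' u → ∀ t < 0, ∀ x, u t x = 0 := by
  obtain ⟨c₁, hc₁, hc⟩ := h C₀ (hC₀'.trans_le hle)
  refine ⟨c₁, hc₁, fun c h1 h2 u p hsol hdss hI => hc c h1 h2 u p hsol hdss fun t ht x => ?_⟩
  refine (hI t ht x).trans ?_
  have hden : 0 < ‖x‖ + Real.sqrt (-t) :=
    add_pos_of_nonneg_of_pos (norm_nonneg _) (Real.sqrt_pos.2 (by linarith))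
  exact div_le_div_of_nonneg_right hle hden.le

/-! ### Theorem 1.1: `λ`-DSS solutions in `C((−∞,0); Lᵖ)` are Type I (regular off the origin) -/

/-- **Chae–Wolf 2017, Theorem 1.1 (backward `λ`-DSS solutions are regular off the origin, with a
Type I bound).** "For `3 ≤ p < +∞` let `u ∈ C((−∞, 0); Lᵖ(ℝ³)) ∩ C^∞(Q)` be a solution to the
Navier–Stokes equations, and `λ`-DSS for some `λ ∈ (1, +∞)`. Then the solution `u` is regular on
`Q̄ ∖ {(0,0)}`, and satisfies the estimate `|u(x,t)| ≤ C/(√(−t) + |x|)` for all `(x,t) ∈ Q`."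
Statement: for every real `q` with `3 ≤ q`, every `c > 1`, every classical solution `(u, p)` of the
unforced Navier–Stokes equations with viscosity `1` on the time set `(−∞, 0)`
(`IsClassicalNSSolutionOn (Iio 0) 1 0 u p`) such that every slice `u t`, `t < 0`, is in `L^q(ℝ³)`
and `t ↦ u t` is continuous into `L^q` on `(−∞,0)` (`‖u t − u t₀‖_{L^q} → 0` as `t → t₀` within
`(−∞,0)`), and which is `c`-discretely self-similar (`IsDiscretelySelfSimilar c u`), admits a
constant `C` with `‖u(t,x)‖ ≤ C/(‖x‖ + √(−t))` for all `t < 0`, `x` (`HasTypeIDecay C u`). The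
regularity near `(x₀, 0)`, `x₀ ≠ 0`, follows from this bound and is not restated. [cite: ChaeWolf2017RemovingDSS, Theorem 1.1 (arXiv:1610.09464 p. 3, estimate (1.5))] -/
def chaeWolf2017_dss_typeI_decay : Prop :=
  ∀ q : ℝ, 3 ≤ q → ∀ c : ℝ, 1 < c →
    ∀ (u : ℝ → ℝ³ → ℝ³) (p : ℝ → ℝ³ → ℝ), IsClassicalNSSolutionOn (Iio 0) 1 0 u p →
      (∀ t < 0, MemLp (u t) (ENNReal.ofReal q) volume) →
      (∀ t₀ < 0, Filter.Tendsto (fun t => eLpNorm (u t - u t₀) (ENNReal.ofReal q) volume)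
        (nhdsWithin t₀ (Iio 0)) (nhds 0)) →
      IsDiscretelySelfSimilar c u → ∃ C : ℝ, HasTypeIDecay C u

/-- Under Theorem 1.1 the Type I constant may be taken positive. [folklore] -/
theorem chaeWolf2017_dss_typeI_decay.exists_pos (h : chaeWolf2017_dss_typeI_decay) {q : ℝ}
    (hq : 3 ≤ q) {c : ℝ} (hc : 1 < c) {u : ℝ → ℝ³ → ℝ³} {p : ℝ → ℝ³ → ℝ}
    (hsol : IsClassicalNSSolutionOn (Iio 0) 1 0 u p)
    (hLp : ∀ t < 0, MemLp (u t) (ENNReal.ofReal q) volume)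
    (hcont : ∀ t₀ < 0, Filter.Tendsto (fun t => eLpNorm (u t - u t₀) (ENNReal.ofReal q) volume)
      (nhdsWithin t₀ (Iio 0)) (nhds 0))
    (hdss : IsDiscretelySelfSimilar c u) : ∃ C : ℝ, 0 < C ∧ HasTypeIDecay C u := by
  obtain ⟨C, hC⟩ := h q hq c hc u p hsol hLp hcont hdss
  refine ⟨max C 1, lt_max_of_lt_right one_pos, fun t ht x => (hC t ht x).trans ?_⟩
  have hden : 0 < ‖x‖ + Real.sqrt (-t) :=
    add_pos_of_nonneg_of_pos (norm_nonneg _) (Real.sqrt_pos.2 (by linarith))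
  exact div_le_div_of_nonneg_right (le_max_left _ _) hden.le

/-- Theorem 1.1 feeds Theorem 1.3: for `C((−∞,0); L^q)` `λ`-DSS classical solutions the Type I
hypothesis of `chaeWolf2017_removing_dss` is automatic, so for `λ` below the removal threshold of
ITS OWN Type I constant such a solution vanishes. (Bookkeeping composition of the two printed
theorems; the threshold depends on the solution through `C`.) [cite: ChaeWolf2017RemovingDSS, Theorems 1.1 and 1.3] -/
theorem chaeWolf2017_dss_typeI_decay.removing (h₁ : chaeWolf2017_dss_typeI_decay)
    (h₃ : chaeWolf2017_removing_dss) {q : ℝ} (hq : 3 ≤ q) {c : ℝ} (hc : 1 < c)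
    {u : ℝ → ℝ³ → ℝ³} {p : ℝ → ℝ³ → ℝ} (hsol : IsClassicalNSSolutionOn (Iio 0) 1 0 u p)
    (hLp : ∀ t < 0, MemLp (u t) (ENNReal.ofReal q) volume)
    (hcont : ∀ t₀ < 0, Filter.Tendsto (fun t => eLpNorm (u t - u t₀) (ENNReal.ofReal q) volume)
      (nhdsWithin t₀ (Iio 0)) (nhds 0))
    (hdss : IsDiscretelySelfSimilar c u) :
    ∃ C c₁ : ℝ, 0 < C ∧ HasTypeIDecay C u ∧ 1 < c₁ ∧ (c < c₁ → ∀ t < 0, ∀ x, u t x = 0) := by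
  obtain ⟨C, hC, hI⟩ := h₁.exists_pos hq hc hsol hLp hcont hdss
  obtain ⟨c₁, hc₁, H⟩ := h₃ C hC
  exact ⟨C, c₁, hC, hI, hc₁, fun hlt => H c hc hlt u p hsol hdss hI⟩

/-! ### Theorem 1.5: asymptotically `λ`-DSS singularities with `λ` close to `1` are regular points -/

/-- **Chae–Wolf 2017, Theorem 1.5 (removing asymptotically discretely self-similar singularities
with scaling factor close to `1`).** "Let `3 ≤ p < +∞` and `u ∈ C([0, t_*); Lᵖ(ℝ³))` be a local in
time smooth solution to (NS). Suppose there exists `v(x,t) ∈ C((−∞, 0); Lᵖ(ℝ³))`, fulfilling the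
inequality (1.7) [`|v(x,t)| ≤ C_*/(√(−t) + |x|)`], which is a `λ`-DSS function with respect to
`(x_*, t_*)` with `λ ∈ (1, λ_*)` for `λ_*` according to Theorem 1.3 such that
`lim_{t→t_*} (t_*−t)^{(p−3)/(2p)} sup_{t<τ<t_*} ‖u(·,τ) − v(·,τ)‖_{Lᵖ(B_{R√(t_*−t)}(x_*))} = 0 ∀ R > 0`
(1.8). Then, `v = 0`, and `(x_*, t_*)` is a regular point." (Remark 1.6: "`v` in (1.8) is a DSS
function (not DSS solution of NS), and due to the factor `(t_*−t)^{(p−3)/(2p)} → 0` for `p > 3` the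
'convergence' `u → v` in `Lᵖ(B_{R√(t_*−t)}(x_*))` is not guaranteed in general.")
Statement (time-first fields): for every `C₀ > 0` there is `c₁ > 1` (the `λ_*(C_*)` of Theorem 1.3,
`chaeWolf2017_removing_dss`) such that for all `1 < c < c₁`, all real `q ≥ 3`, every blow-up
time/point candidate `(t_*, x_*)` with `t_* > 0`, every classical solution `(u, p)` of the unforced
Navier–Stokes equations with viscosity `1` on the time set `[0, t_*)`
(`IsClassicalNSSolutionOn (Ico 0 t_*) 1 0 u p`) whose slices lie in `L^q(ℝ³)` and depend
continuously on `t ∈ [0, t_*)` in `L^q` (the printed `u ∈ C([0,t_*); Lᵖ)`), and every MODEL field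
`w : ℝ → ℝ³ → ℝ³` — the printed `v` in the variables centred at `(t_*, x_*)`,
`v(τ, x) = w(τ − t_*, x − x_*)` — with slices `w(s) ∈ L^q`, `s < 0`, continuous in `L^q` on
`(−∞, 0)`, `c`-discretely self-similar (`IsDiscretelySelfSimilar c w`, i.e. `v` is `λ`-DSS with
respect to `(x_*, t_*)`) and Type-I bounded (`HasTypeIDecay C₀ w`, (1.7)): IF the asymptotic
condition (1.8) holds — for every `R > 0`,
`(t_*−t)^{(q−3)/(2q)} · sup_{t<τ<t_*} ‖u(τ) − v(τ)‖_{L^q(B(x_*, R√(t_*−t)))} → 0` as `t ↑ t_*` —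
THEN `w(s) = 0` a.e. for every `s < 0` (the printed `v = 0`) and `u` is bounded on some backward
parabolic cylinder `(t_* − r², t_*) × B(x_*, r)` (the printed "`(x_*, t_*)` is a regular point";
this is `IsBackwardBoundedAt u t_* x_*` of `SereginSverak2002PressureLowerBound.lean`, unfolded).
[cite: ChaeWolf2017RemovingDSS, Theorem 1.5 and Remark 1.6 (arXiv:1610.09464 pp. 3–4; proof §4 p. 10)] -/
def chaeWolf2017_asymptoticallyDSS_regular : Prop :=
  ∀ C₀ : ℝ, 0 < C₀ → ∃ c₁ : ℝ, 1 < c₁ ∧ ∀ c : ℝ, 1 < c → c < c₁ →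
    ∀ q : ℝ, 3 ≤ q → ∀ (tStar : ℝ) (xStar : ℝ³), 0 < tStar →
    ∀ (u : ℝ → ℝ³ → ℝ³) (p : ℝ → ℝ³ → ℝ) (w : ℝ → ℝ³ → ℝ³),
      IsClassicalNSSolutionOn (Ico 0 tStar) 1 0 u p →
      (∀ t ∈ Ico 0 tStar, MemLp (u t) (ENNReal.ofReal q) volume) →
      (∀ t₀ ∈ Ico 0 tStar, Filter.Tendsto (fun t => eLpNorm (u t - u t₀) (ENNReal.ofReal q) volume)
        (nhdsWithin t₀ (Ico 0 tStar)) (nhds 0)) →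
      (∀ s < 0, MemLp (w s) (ENNReal.ofReal q) volume) →
      (∀ s₀ < 0, Filter.Tendsto (fun s => eLpNorm (w s - w s₀) (ENNReal.ofReal q) volume)
        (nhdsWithin s₀ (Iio 0)) (nhds 0)) →
      IsDiscretelySelfSimilar c w → HasTypeIDecay C₀ w →
      (∀ R : ℝ, 0 < R → Filter.Tendsto
        (fun t => ENNReal.ofReal ((tStar - t) ^ ((q - 3) / (2 * q))) *
          ⨆ τ ∈ Ioo t tStar, eLpNorm (u τ - fun x => w (τ - tStar) (x - xStar)) (ENNReal.ofReal q)
            (volume.restrict (Metric.ball xStar (R * Real.sqrt (tStar - t)))))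
        (nhdsWithin tStar (Iio tStar)) (nhds 0)) →
      (∀ s < 0, w s =ᵐ[volume] 0) ∧
        ∃ r > 0, ∃ M : ℝ, ∀ t ∈ Ioo (tStar - r ^ 2) tStar, ∀ x ∈ Metric.ball xStar r, ‖u t x‖ ≤ M

/-- Under Theorem 1.5, the regular-point conclusion alone, in the shape used by the census seats:
an asymptotically `c`-DSS (`1 < c < c₁(C₀)`), Type-I-enveloped blow-up candidate `(t_*, x_*)` of a
classical solution with `L^q`-continuous slices is NOT a singular point — `u` is bounded on a backward
parabolic cylinder at `(t_*, x_*)`. [cite: ChaeWolf2017RemovingDSS, Theorem 1.5] -/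
theorem chaeWolf2017_asymptoticallyDSS_regular.backwardBounded
    (h : chaeWolf2017_asymptoticallyDSS_regular) {C₀ : ℝ} (hC₀ : 0 < C₀) :
    ∃ c₁ : ℝ, 1 < c₁ ∧ ∀ c : ℝ, 1 < c → c < c₁ →
    ∀ q : ℝ, 3 ≤ q → ∀ (tStar : ℝ) (xStar : ℝ³), 0 < tStar →
    ∀ (u : ℝ → ℝ³ → ℝ³) (p : ℝ → ℝ³ → ℝ) (w : ℝ → ℝ³ → ℝ³),
      IsClassicalNSSolutionOn (Ico 0 tStar) 1 0 u p →
      (∀ t ∈ Ico 0 tStar, MemLp (u t) (ENNReal.ofReal q) volume) →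
      (∀ t₀ ∈ Ico 0 tStar, Filter.Tendsto (fun t => eLpNorm (u t - u t₀) (ENNReal.ofReal q) volume)
        (nhdsWithin t₀ (Ico 0 tStar)) (nhds 0)) →
      (∀ s < 0, MemLp (w s) (ENNReal.ofReal q) volume) →
      (∀ s₀ < 0, Filter.Tendsto (fun s => eLpNorm (w s - w s₀) (ENNReal.ofReal q) volume)
        (nhdsWithin s₀ (Iio 0)) (nhds 0)) →
      IsDiscretelySelfSimilar c w → HasTypeIDecay C₀ w →
      (∀ R : ℝ, 0 < R → Filter.Tendsto
        (fun t => ENNReal.ofReal ((tStar - t) ^ ((q - 3) / (2 * q))) *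
          ⨆ τ ∈ Ioo t tStar, eLpNorm (u τ - fun x => w (τ - tStar) (x - xStar)) (ENNReal.ofReal q)
            (volume.restrict (Metric.ball xStar (R * Real.sqrt (tStar - t)))))
        (nhdsWithin tStar (Iio tStar)) (nhds 0)) →
      ∃ r > 0, ∃ M : ℝ, ∀ t ∈ Ioo (tStar - r ^ 2) tStar, ∀ x ∈ Metric.ball xStar r, ‖u t x‖ ≤ M := by
  obtain ⟨c₁, hc₁, H⟩ := h C₀ hC₀
  refine ⟨c₁, hc₁, fun c h1 h2 q hq tStar xStar ht u p w hsol hLp hcont hwLp hwcont hdss hI has => ?_⟩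
  exact (H c h1 h2 q hq tStar xStar ht u p w hsol hLp hcont hwLp hwcont hdss hI has).2


end Literature.Analysis.FluidPDE

end
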